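import Summits.CriticalPhenomena.SAWScalingLimit.Theses.SAWConePseudogroup
import Literature.Probability.RandomPlanarGeometry.SAWScalingLimitFamily

/-!
# Line `birth` — registered skeleton for the crux `ContinuityOfLimit` (stmt-CriticalPhenomena-7305)

Crux (FIXED; rank 4 of `route-CriticalPhenomena-SAWConePseudogroup`, shared verbatim with
`route-CriticalPhenomena-SAWRestrictionDescent`): every chordal family `P` that is the FULL scaling limit
`(lim)` of the critical `δℤ²` SAW laws (every Dobrushin domain, EVERY endpoint approximation) is
sequentially continuous along conformal images: if `Φₙ → Φ` uniformly on `closure D`, each `Φₙ`, `Φ`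
conformal on `D` and injective on `closure D`, `Dₙ = Φₙ(D)`, `D' = Φ(D)` with image marks, then
`∫ f dP(Dₙ) → ∫ f dP(D')` for every bounded continuous `f` on `CurveClass ℂ`.

## The cut: interchange of limits through an INNER domain (Moore–Osgood + lattice restriction geometry)

Closeness of marked domains to the REFERENCE domain `D'` is measured by a map of the closed domain:
`Close η D' D''` := some `ψ`, continuous and injective on `closure D'`, carries `D'` onto `D''`, the two
marks onto the two marks, and moves no point of `closure D'` by more than `η` (a Fréchet `η`-closeness of
the boundary loops together with the marks). It is INLINED in both stubs (tree vocabulary only), so each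
stub lands verbatim as a `Theorems/…` file `--supports stmt-CriticalPhenomena-7305`.

* S1 `stub_innerStability` (LOAD-BEARING; the SAW estimate) — UNIFORM-IN-MESH STABILITY OF THE CRITICAL
  SAW LAW UNDER PASSAGE TO AN INNER DOMAIN: for every reference domain `D'`, test function `f` and `ε > 0`
  there is `η > 0` such that for every Dobrushin domain `D₂ ⊆ D'` that is `η`-close to `D'` there is
  `η' > 0` such that for every Dobrushin domain `D₁ ⊇ D₂` that is `η'`-close to `D'`, EVENTUALLY IN THE
  MESH `δ → 0⁺`, for all lattice endpoints `u₁, v₁` joined in `(D₁)_δ` and `u₂, v₂` joined in `(D₂)_δ`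
  lying within `η'` of the respective marks, the `f`-integrals of the critical SAW laws
  `law (D₁)_δ (u₁, v₁)` and `law (D₂)_δ (u₂, v₂)` differ by at most `ε`. Since `D₂ ⊆ D₁`, the lattice
  restriction identity (LSW04 §3.4.5: the SAW in the smaller graph is the SAW in the bigger graph
  conditioned to stay inside, same endpoints) reduces it to (i) uniform boundary avoidance away from the
  marks ("no boundary crawling", cf. `SimpleOfLimit` stmt-0774) and (ii) endpoint regularity near the marks
  (Kennedy–Lawler lattice effects cancel in the two-point NORMALISED law; cf. `EndpointRobust` stmt-0776,
  which is the `D₁ = D₂` shadow in the limit). Its `δ → 0⁺` shadow under the conjunct is Radó-type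
  continuity of chordal SLE_{8/3} laws in (Fréchet-close boundary, close marks). Size L. The `η'`-modulus
  must serve every `D₁` near `D'` (the route needs a SEQUENCE `Dₙ → D'`), but the mesh threshold may
  depend on the pair `(D₁, D₂)` (`∀ᶠ δ` sits inside).
* S2 `stub_innerApproximation` (deterministic plane geometry / complex analysis) — INNER JORDAN
  APPROXIMATION SWALLOWED BY EVERY NEARBY DOMAIN: every Dobrushin domain `D'` has, for every `ε > 0`, a
  Dobrushin sub-domain `D₃ ⊆ D'` that is `ε`-close to `D'` and is contained in EVERY Dobrushin domain
  `η`-close to `D'`, for some `η > 0`. Construction: `D₃ = h(r𝔻)` for a Riemann map `h : 𝔻 → D'` with its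
  Carathéodory extension (tree: `exists_conformalEquiv_ball_holds`,
  `JordanDomain.exists_continuousOn_extension_holds`), `ψ₃ = h ∘ (r ·) ∘ h⁻¹`, `r ↑ 1` by uniform
  continuity of `h` on the closed disc; containment: `∂D'' = ψ(∂D')` stays within `η` of `∂D'`, hence
  misses `D₃` once `η < dist (closure D₃, ∂D')`, and `ψ(h 0)` lies in `D₃ ∩ D''`, so the connected `D₃`
  lies inside `D''`. Size M–L (a `DobrushinDomain` structure must be built for `h(r𝔻)`).

`ContinuityOfLimit_of` (kernel-checked, no `sorry` of its own, ~100 lines): fix `f`, `ε`; S1 at `D'`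
with `ε/3` gives `η`; S2 gives `D₃ ⊆ D'`, `η`-close, and its swallowing radius `η₃`; S1 gives the outer
modulus `η'` for `D₃`; the PROVED geometric lemma `close_of_tendstoUniformlyOn` (the crux hypotheses make
`Dₙ` eventually `min η' η₃`-close to `D'`, via `ψₙ = Φₙ ∘ Φ⁻¹` on `closure D' = Φ(closure D)`, inverse
continuous on the compact set) gives `N`; for `n ≥ N`, `D₃ ⊆ Dₙ`, and S1 applied to the pairs `(Dₙ, D₃)`
and `(D', D₃)` (the reference domain is `0`-close to itself, `close_refl`) bounds the lattice integrals
eventually in `δ`, along endpoint approximations that exist by the tree theorem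
`SAW.exists_isEndpointApprox`; `(lim)` at `Dₙ`, `D'`, `D₃` and `le_of_tendsto` along the proper filter
`𝓝[>] 0` pass the two bounds to the limit (`abs_sub_integral_le_of_lattice`), and the triangle inequality
through `∫ f dP(D₃)` gives `dist (∫ f dP(Dₙ)) (∫ f dP(D')) ≤ 2ε/3 < ε`.

Disproof used: none exists for this crux (`ledger crux ls stmt-CriticalPhenomena-7305`: no workfiles,
2026-08-17); negatives index (11 entries) checked — the only SAW-law entry, `SAWParafermionTight_refuted`
(stmt-0772: tightness over ALL `δ ∈ (0,1]`), is avoided because both stubs only speak `∀ᶠ δ in 𝓝[>] 0`.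
-/

noncomputable section

open MeasureTheory Filter Topology Set
open Literature.Probability.RandomPlanarGeometry Literature.Probability.LatticeModels

namespace Summit.CriticalPhenomena.SAWScalingLimit.Cruxes.ContinuityOfLimit.Birth

/-! ### Vocabulary of the line -/

/-- **Closeness of a marked domain to the reference domain `D'`** (inlined verbatim in the stubs):
some map `ψ` of the plane, continuous and injective on `closure D'`, carries `D'` onto `D''` and the
marks onto the marks, and moves no point of `closure D'` by more than `η`. -/
def Close (η : ℝ) (D' D'' : DobrushinDomain) : Prop :=
  ∃ ψ : ℂ → ℂ, ContinuousOn ψ (closure D'.carrier) ∧ InjOn ψ (closure D'.carrier) ∧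
    D''.carrier = ψ '' D'.carrier ∧ D''.pt 0 = ψ (D'.pt 0) ∧ D''.pt 1 = ψ (D'.pt 1) ∧
    ∀ z ∈ closure D'.carrier, dist (ψ z) z ≤ η

/-- **S1, named.** Uniform-in-mesh stability of the critical SAW law under passage to an inner domain
(see the module docstring). -/
def InnerStability : Prop :=
  ∀ (D' : DobrushinDomain) (f : BoundedContinuousFunction (CurveClass ℂ) ℝ) (ε : ℝ), 0 < ε →
    ∃ η : ℝ, 0 < η ∧ ∀ D₂ : DobrushinDomain, Close η D' D₂ → D₂.carrier ⊆ D'.carrier →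
      ∃ η' : ℝ, 0 < η' ∧ ∀ D₁ : DobrushinDomain, Close η' D' D₁ → D₂.carrier ⊆ D₁.carrier →
        ∀ᶠ δ in 𝓝[>] (0 : ℝ), ∀ u₁ v₁ u₂ v₂ : Site 2,
          (discreteDomainGraph D₁.carrier δ).Reachable u₁ v₁ →
          (discreteDomainGraph D₂.carrier δ).Reachable u₂ v₂ →
          dist (meshPoint δ u₁) (D₁.pt 0) ≤ η' → dist (meshPoint δ v₁) (D₁.pt 1) ≤ η' →
          dist (meshPoint δ u₂) (D₂.pt 0) ≤ η' → dist (meshPoint δ v₂) (D₂.pt 1) ≤ η' →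
          |(∫ γ, f γ.curve ∂(SAW.law D₁.carrier δ u₁ v₁)) -
              ∫ γ, f γ.curve ∂(SAW.law D₂.carrier δ u₂ v₂)| ≤ ε

/-- **S2, named.** Inner Jordan approximation swallowed by every nearby domain (see the module
docstring). -/
def InnerApproximation : Prop :=
  ∀ (D' : DobrushinDomain) (ε : ℝ), 0 < ε →
    ∃ D₃ : DobrushinDomain, D₃.carrier ⊆ D'.carrier ∧ Close ε D' D₃ ∧
      ∃ η : ℝ, 0 < η ∧ ∀ D'' : DobrushinDomain, Close η D' D'' → D₃.carrier ⊆ D''.carrier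

/-! ### The stubs (the ONLY `sorry`s of this file)

Both are stated over TREE VOCABULARY ONLY (`Close` unfolded by hand), so that each lands verbatim as a
`Theorems/…` file `--supports stmt-CriticalPhenomena-7305` without importing this workfile; the `*_holds`
theorems below certify definitionally that the unfolded text IS the named statement. -/

/-- **S1 — uniform-in-mesh stability of the critical SAW law under passage to an inner domain.**
For every reference Dobrushin domain `D'`, every bounded continuous `f` on curve classes and every
`ε > 0` there is `η > 0` such that for every Dobrushin domain `D₂ ⊆ D'` that is `η`-close to `D'`
(through a map of `closure D'` continuous, injective, onto, marks to marks, moving points by `≤ η`) there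
is `η' > 0` such that for every Dobrushin domain `D₁ ⊇ D₂` that is `η'`-close to `D'`, eventually as the
mesh `δ → 0⁺`, for all lattice endpoints `u₁, v₁` joined in `(D₁)_δ` and `u₂, v₂` joined in `(D₂)_δ`
within `η'` of the respective marked points, the `f`-integrals of the critical SAW laws in `(D₁)_δ` from
`u₁` to `v₁` and in `(D₂)_δ` from `u₂` to `v₂` differ by at most `ε`. (Lattice restriction reduces it to
uniform boundary avoidance away from the marks plus endpoint regularity near them; its `δ → 0⁺` shadow
under the conjunct is Radó continuity of chordal SLE_{8/3} in the domain and the marks.) -/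
theorem stub_innerStability :
    ∀ (D' : DobrushinDomain) (f : BoundedContinuousFunction (CurveClass ℂ) ℝ) (ε : ℝ), 0 < ε →
      ∃ η : ℝ, 0 < η ∧ ∀ D₂ : DobrushinDomain,
        (∃ ψ : ℂ → ℂ, ContinuousOn ψ (closure D'.carrier) ∧ InjOn ψ (closure D'.carrier) ∧
          D₂.carrier = ψ '' D'.carrier ∧ D₂.pt 0 = ψ (D'.pt 0) ∧ D₂.pt 1 = ψ (D'.pt 1) ∧
          ∀ z ∈ closure D'.carrier, dist (ψ z) z ≤ η) →
        D₂.carrier ⊆ D'.carrier →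
        ∃ η' : ℝ, 0 < η' ∧ ∀ D₁ : DobrushinDomain,
          (∃ ψ : ℂ → ℂ, ContinuousOn ψ (closure D'.carrier) ∧ InjOn ψ (closure D'.carrier) ∧
            D₁.carrier = ψ '' D'.carrier ∧ D₁.pt 0 = ψ (D'.pt 0) ∧ D₁.pt 1 = ψ (D'.pt 1) ∧
            ∀ z ∈ closure D'.carrier, dist (ψ z) z ≤ η') →
          D₂.carrier ⊆ D₁.carrier →
          ∀ᶠ δ in 𝓝[>] (0 : ℝ), ∀ u₁ v₁ u₂ v₂ : Site 2,
            (discreteDomainGraph D₁.carrier δ).Reachable u₁ v₁ →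
            (discreteDomainGraph D₂.carrier δ).Reachable u₂ v₂ →
            dist (meshPoint δ u₁) (D₁.pt 0) ≤ η' → dist (meshPoint δ v₁) (D₁.pt 1) ≤ η' →
            dist (meshPoint δ u₂) (D₂.pt 0) ≤ η' → dist (meshPoint δ v₂) (D₂.pt 1) ≤ η' →
            |(∫ γ, f γ.curve ∂(SAW.law D₁.carrier δ u₁ v₁)) -
                ∫ γ, f γ.curve ∂(SAW.law D₂.carrier δ u₂ v₂)| ≤ ε := by
  sorry

/-- **S2 — inner Jordan approximation swallowed by every nearby domain.** For every Dobrushin domain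
`D'` and `ε > 0` there is a Dobrushin domain `D₃ ⊆ D'`, `ε`-close to `D'` (through a map of
`closure D'` continuous, injective, onto `D₃` on `D'`, marks to marks, moving points by `≤ ε`), and an
`η > 0` such that every Dobrushin domain `η`-close to `D'` contains `D₃`. (`D₃ = h(r𝔻)` for a Riemann
map `h` of `D'` with its Carathéodory extension, `ψ₃ = h ∘ (r ·) ∘ h⁻¹`, `r ↑ 1`; containment by
`∂D'' = ψ(∂D')` missing `D₃` and connectedness of `D₃`.) -/
theorem stub_innerApproximation :
    ∀ (D' : DobrushinDomain) (ε : ℝ), 0 < ε →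
      ∃ D₃ : DobrushinDomain, D₃.carrier ⊆ D'.carrier ∧
        (∃ ψ : ℂ → ℂ, ContinuousOn ψ (closure D'.carrier) ∧ InjOn ψ (closure D'.carrier) ∧
          D₃.carrier = ψ '' D'.carrier ∧ D₃.pt 0 = ψ (D'.pt 0) ∧ D₃.pt 1 = ψ (D'.pt 1) ∧
          ∀ z ∈ closure D'.carrier, dist (ψ z) z ≤ ε) ∧
        ∃ η : ℝ, 0 < η ∧ ∀ D'' : DobrushinDomain,
          (∃ ψ : ℂ → ℂ, ContinuousOn ψ (closure D'.carrier) ∧ InjOn ψ (closure D'.carrier) ∧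
            D''.carrier = ψ '' D'.carrier ∧ D''.pt 0 = ψ (D'.pt 0) ∧ D''.pt 1 = ψ (D'.pt 1) ∧
            ∀ z ∈ closure D'.carrier, dist (ψ z) z ≤ η) →
          D₃.carrier ⊆ D''.carrier := by
  sorry

/-! ### Consistency: each named statement IS its registered stub (definitionally) -/

theorem innerStability_holds : InnerStability := stub_innerStability
theorem innerApproximation_holds : InnerApproximation := stub_innerApproximation

/-! ### Name-keyed aliases of the two statements — the hypotheses of `ContinuityOfLimit_of`

The native skeleton audit (`#h21_check_skeleton`) admits a hypothesis of the skeleton theorem only if its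
head constant is a registered obligation or is NAMED like a declared stub; `__Registered.stub_X` is the
statement of `stub_X` under that name (device of `Cruxes/AxiomsOfLimit/Lines/birth.lean`: the `__`
namespace is an implementation detail, so the audit's stub report resolves each `stub_…` to the sorried
theorem, not to the alias). Each alias is `rfl`-equal to its statement. -/
namespace __Registered

/-- Alias of `InnerStability` keyed by the registered stub name. -/
abbrev stub_innerStability : Prop := InnerStability
/-- Alias of `InnerApproximation` keyed by the registered stub name. -/
abbrev stub_innerApproximation : Prop := InnerApproximation

end __Registered

/-! ### Proved glue of the line (no `sorry`) -/

/-- Closeness is monotone in the tolerance. -/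
theorem Close.mono {η η' : ℝ} {D' D'' : DobrushinDomain} (h : Close η D' D'') (hle : η ≤ η') :
    Close η' D' D'' := by
  obtain ⟨ψ, hc, hi, hcar, h0, h1, hd⟩ := h
  exact ⟨ψ, hc, hi, hcar, h0, h1, fun z hz => (hd z hz).trans hle⟩

/-- The reference domain is `η`-close to itself for every `η ≥ 0` (`ψ = id`). -/
theorem close_refl (D' : DobrushinDomain) {η : ℝ} (hη : 0 ≤ η) : Close η D' D' :=
  ⟨id, continuousOn_id, injOn_id _, by simp, rfl, rfl, fun z _ => by simpa using hη⟩

/-- A map continuous and injective on a compact set `K` has an inverse continuous on its image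
(`f|K` is a closed map). Re-proved here (the tree's copy lives in a percolation file not imported). -/
theorem continuousOn_invFunOn_of_isCompact {f : ℂ → ℂ} {K : Set ℂ} (hK : IsCompact K)
    (hf : ContinuousOn f K) (hinj : InjOn f K) :
    ContinuousOn (Function.invFunOn f K) (f '' K) := by
  rw [continuousOn_iff_isClosed]
  intro t ht
  refine ⟨f '' (t ∩ K),
    ((hK.inter_left ht).image_of_continuousOn (hf.mono inter_subset_right)).isClosed, ?_⟩
  ext w
  constructor
  · rintro ⟨hw, z, hz, rfl⟩
    rw [mem_preimage, hinj.leftInvOn_invFunOn hz] at hw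
    exact ⟨⟨z, ⟨hw, hz⟩, rfl⟩, z, hz, rfl⟩
  · rintro ⟨⟨z, ⟨hzt, hzK⟩, rfl⟩, -⟩
    refine ⟨?_, z, hzK, rfl⟩
    rw [mem_preimage, hinj.leftInvOn_invFunOn hzK]
    exact hzt

/-- **The geometric interface (proved).** Under the hypotheses of the crux — `Φₙ → Φ` uniformly on
`closure D`, `Φ` injective on `closure D`, every `Φₙ` injective on `closure D`, `D' = Φ(D)` and
`Dₙ = Φₙ(D)` with image marks — the domains `Dₙ` are eventually `η`-close to `D'` for every `η > 0`:
`ψₙ = Φₙ ∘ Φ⁻¹` on `closure D' = Φ(closure D)` (compactness of `closure D`; the inverse of `Φ` is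
continuous there). -/
theorem close_of_tendstoUniformlyOn {D D' : DobrushinDomain} {Dn : ℕ → DobrushinDomain}
    {Φ : C(ℂ, ℂ)} {Φn : ℕ → C(ℂ, ℂ)}
    (hunif : TendstoUniformlyOn (fun n => ⇑(Φn n)) Φ atTop (closure D.carrier))
    (hinj : InjOn Φ (closure D.carrier))
    (hΦn : ∀ n, DifferentiableOn ℂ (Φn n) D.carrier ∧ InjOn (Φn n) (closure D.carrier))
    (hcar : D'.carrier = Φ '' D.carrier) (h0 : D'.pt 0 = Φ (D.pt 0)) (h1 : D'.pt 1 = Φ (D.pt 1))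
    (hDn : ∀ n, (Dn n).carrier = Φn n '' D.carrier ∧ (Dn n).pt 0 = Φn n (D.pt 0) ∧
      (Dn n).pt 1 = Φn n (D.pt 1))
    {η : ℝ} (hη : 0 < η) :
    ∀ᶠ n in atTop, Close η D' (Dn n) := by
  have hKc : IsCompact (closure D.carrier) := D.isBounded.isCompact_closure
  -- `closure D' = Φ '' closure D`
  have hclos : closure D'.carrier = Φ '' closure D.carrier := by
    rw [hcar]
    exact subset_antisymm
      (closure_minimal (image_mono subset_closure) (hKc.image Φ.continuous).isClosed)
      (image_closure_subset_closure_image Φ.continuous)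
  -- the inverse of `Φ` on `closure D`, continuous on `closure D'`
  set g : ℂ → ℂ := Function.invFunOn Φ (closure D.carrier) with hg
  have hgK : ∀ x ∈ closure D.carrier, g (Φ x) = x := fun x hx => hinj.leftInvOn_invFunOn hx
  have hgc : ContinuousOn g (Φ '' closure D.carrier) :=
    continuousOn_invFunOn_of_isCompact hKc Φ.continuous.continuousOn hinj
  have hpt : ∀ i : Fin 2, D.pt i ∈ closure D.carrier := fun i =>
    frontier_subset_closure (D.pt_mem_frontier i)
  -- uniform closeness, eventually
  have hev : ∀ᶠ n in atTop, ∀ x ∈ closure D.carrier, dist (Φ x) (Φn n x) < η :=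
    Metric.tendstoUniformlyOn_iff.1 hunif η hη
  filter_upwards [hev] with n hn
  refine ⟨fun w => Φn n (g w), ?_, ?_, ?_, ?_, ?_, ?_⟩
  · -- continuity on `closure D'`
    rw [hclos]
    exact (Φn n).continuous.comp_continuousOn hgc
  · -- injectivity on `closure D'`
    rw [hclos]
    rintro _ ⟨x, hx, rfl⟩ _ ⟨y, hy, rfl⟩ hxy
    have hxy' : Φn n x = Φn n y := by simpa only [hgK x hx, hgK y hy] using hxy
    rw [(hΦn n).2 hx hy hxy']
  · -- the carrier
    rw [(hDn n).1, hcar, image_image]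
    refine EqOn.image_eq fun x hx => ?_
    show Φn n x = Φn n (g (Φ x))
    rw [hgK x (subset_closure hx)]
  · -- first mark
    rw [(hDn n).2.1, h0]
    show Φn n (D.pt 0) = Φn n (g (Φ (D.pt 0)))
    rw [hgK _ (hpt 0)]
  · -- second mark
    rw [(hDn n).2.2, h1]
    show Φn n (D.pt 1) = Φn n (g (Φ (D.pt 1)))
    rw [hgK _ (hpt 1)]
  · -- displacement at most `η`
    rw [hclos]
    rintro _ ⟨x, hx, rfl⟩
    show dist (Φn n (g (Φ x))) (Φ x) ≤ η
    rw [hgK x hx, dist_comm]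
    exact (hn x hx).le

/-- **Passage to the limit (proved).** If, eventually in the mesh, the `f`-integrals of the critical
SAW laws in `(D₁)_δ` and `(D₂)_δ` differ by at most `ε` for all joined endpoints within `η'` of the
marks, and along two endpoint approximations the integrals converge to `∫ f dP(D₁)`, `∫ f dP(D₂)`,
then `|∫ f dP(D₁) - ∫ f dP(D₂)| ≤ ε` (`𝓝[>] 0` is a proper filter; `le_of_tendsto`). -/
theorem abs_sub_integral_le_of_lattice {D₁ D₂ : DobrushinDomain} {P : ChordalFamily}
    {f : BoundedContinuousFunction (CurveClass ℂ) ℝ} {ε η' : ℝ} {a₁ b₁ a₂ b₂ : ℝ → Site 2}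
    (h₁ : SAW.IsEndpointApprox D₁ a₁ b₁) (h₂ : SAW.IsEndpointApprox D₂ a₂ b₂) (hη' : 0 < η')
    (hS : ∀ᶠ δ in 𝓝[>] (0 : ℝ), ∀ u₁ v₁ u₂ v₂ : Site 2,
      (discreteDomainGraph D₁.carrier δ).Reachable u₁ v₁ →
      (discreteDomainGraph D₂.carrier δ).Reachable u₂ v₂ →
      dist (meshPoint δ u₁) (D₁.pt 0) ≤ η' → dist (meshPoint δ v₁) (D₁.pt 1) ≤ η' →
      dist (meshPoint δ u₂) (D₂.pt 0) ≤ η' → dist (meshPoint δ v₂) (D₂.pt 1) ≤ η' →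
      |(∫ γ, f γ.curve ∂(SAW.law D₁.carrier δ u₁ v₁)) -
          ∫ γ, f γ.curve ∂(SAW.law D₂.carrier δ u₂ v₂)| ≤ ε)
    (L₁ : Tendsto (fun δ => ∫ γ, f γ.curve ∂(SAW.law D₁.carrier δ (a₁ δ) (b₁ δ)))
      (𝓝[>] (0 : ℝ)) (𝓝 (∫ γ, f γ ∂(P D₁))))
    (L₂ : Tendsto (fun δ => ∫ γ, f γ.curve ∂(SAW.law D₂.carrier δ (a₂ δ) (b₂ δ)))
      (𝓝[>] (0 : ℝ)) (𝓝 (∫ γ, f γ ∂(P D₂)))) :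
    |(∫ γ, f γ ∂(P D₁)) - ∫ γ, f γ ∂(P D₂)| ≤ ε := by
  have near : ∀ {c : ℂ} {p : ℝ → ℂ}, Tendsto p (𝓝[>] (0 : ℝ)) (𝓝 c) →
      ∀ᶠ δ in 𝓝[>] (0 : ℝ), dist (p δ) c ≤ η' := fun hp =>
    (Metric.tendsto_nhds.1 hp η' hη').mono fun δ hδ => hδ.le
  have hev : ∀ᶠ δ in 𝓝[>] (0 : ℝ),
      |(∫ γ, f γ.curve ∂(SAW.law D₁.carrier δ (a₁ δ) (b₁ δ))) -
          ∫ γ, f γ.curve ∂(SAW.law D₂.carrier δ (a₂ δ) (b₂ δ))| ≤ ε := by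
    filter_upwards [hS, h₁.reachable, h₂.reachable, near h₁.tendsto_fst, near h₁.tendsto_snd,
      near h₂.tendsto_fst, near h₂.tendsto_snd] with δ hSδ hr₁ hr₂ d₁ d₂ d₃ d₄
    exact hSδ _ _ _ _ hr₁ hr₂ d₁ d₂ d₃ d₄
  exact le_of_tendsto (L₁.sub L₂).abs hev

/-! ### The skeleton theorem: the two stubs imply the crux, BY NAME -/

/-- **`ContinuityOfLimit` from the line `birth`** (kernel-checked, no `sorry` of its own): the
Moore–Osgood interchange through an inner domain. Fix `f`, `ε`; S1 at the reference domain `D'` with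
`ε/3` gives `η`; S2 gives an inner domain `D₃ ⊆ D'`, `η`-close to `D'`, swallowed by every `η₃`-close
domain; S1 gives the outer modulus `η'` for `D₃`; `close_of_tendstoUniformlyOn` makes `Dₙ` eventually
`min η' η₃`-close to `D'`, so `D₃ ⊆ Dₙ` and S1 bounds the lattice integrals of the pairs `(Dₙ, D₃)`,
`(D', D₃)` eventually in the mesh; `(lim)` along endpoint approximations (`SAW.exists_isEndpointApprox`)
and `abs_sub_integral_le_of_lattice` pass both bounds to the limit; triangle inequality through
`∫ f dP(D₃)`. Hypotheses = the two stubs under their registered names; conclusion = the route decl. -/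
theorem ContinuityOfLimit_of (hA : __Registered.stub_innerStability)
    (hB : __Registered.stub_innerApproximation) :
    Summit.CriticalPhenomena.SAWScalingLimit.Theses.SAWConePseudogroup.ContinuityOfLimit := by
  intro P _hP hlim D D' Dn Φ Φn hunif _hΦ hinj hΦn hcar h0 h1 hDn f
  rw [Metric.tendsto_atTop]
  intro ε hε
  -- S1 at the reference domain with tolerance ε/3
  obtain ⟨η, hη, hA'⟩ := hA D' f (ε / 3) (by positivity)
  -- S2: an inner domain D₃ ⊆ D', η-close, swallowed by every η₃-close domain
  obtain ⟨D₃, hD₃sub, hD₃close, η₃, hη₃, hD₃in⟩ := hB D' η hη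
  -- S1: the outer modulus for D₃
  obtain ⟨η', hη', hA''⟩ := hA' D₃ hD₃close hD₃sub
  -- the crux hypotheses: Dₙ is eventually close to D'
  obtain ⟨N, hN⟩ := eventually_atTop.1
    (close_of_tendstoUniformlyOn hunif hinj hΦn hcar h0 h1 hDn (lt_min hη' hη₃))
  refine ⟨N, fun n hn => ?_⟩
  have hCn : Close (min η' η₃) D' (Dn n) := hN n hn
  have hD₃n : D₃.carrier ⊆ (Dn n).carrier := hD₃in (Dn n) (hCn.mono (min_le_right _ _))
  -- lattice closeness, eventually in the mesh, for the pairs (Dₙ, D₃) and (D', D₃)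
  have hSn := hA'' (Dn n) (hCn.mono (min_le_left _ _)) hD₃n
  have hS' := hA'' D' (close_refl D' hη'.le) hD₃sub
  -- endpoint approximations and the three limits
  obtain ⟨an, bn, habn⟩ := SAW.exists_isEndpointApprox (Dn n)
  obtain ⟨a', b', hab'⟩ := SAW.exists_isEndpointApprox D'
  obtain ⟨a₃, b₃, hab₃⟩ := SAW.exists_isEndpointApprox D₃
  have key₁ : |(∫ γ, f γ ∂(P (Dn n))) - ∫ γ, f γ ∂(P D₃)| ≤ ε / 3 :=
    abs_sub_integral_le_of_lattice habn hab₃ hη' hSn (hlim (Dn n) an bn habn f)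
      (hlim D₃ a₃ b₃ hab₃ f)
  have key₂ : |(∫ γ, f γ ∂(P D')) - ∫ γ, f γ ∂(P D₃)| ≤ ε / 3 :=
    abs_sub_integral_le_of_lattice hab' hab₃ hη' hS' (hlim D' a' b' hab' f)
      (hlim D₃ a₃ b₃ hab₃ f)
  -- triangle inequality through ∫ f dP(D₃)
  rw [Real.dist_eq]
  calc |(∫ γ, f γ ∂(P (Dn n))) - ∫ γ, f γ ∂(P D')|
      ≤ |(∫ γ, f γ ∂(P (Dn n))) - ∫ γ, f γ ∂(P D₃)| + |(∫ γ, f γ ∂(P D₃)) - ∫ γ, f γ ∂(P D')| :=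
        abs_sub_le _ _ _
    _ ≤ ε / 3 + ε / 3 := add_le_add key₁ (by rwa [abs_sub_comm])
    _ < ε := by linarith

/-- Wiring check (an `example`, so that `ContinuityOfLimit_of` stays the only theorem concluding the
crux): the registered stubs, with their tree-vocabulary types, feed the skeleton theorem as stated — this
term becomes the crux proof when the two `sorry`s above are discharged. -/
example : Summit.CriticalPhenomena.SAWScalingLimit.Theses.SAWConePseudogroup.ContinuityOfLimit :=
  ContinuityOfLimit_of stub_innerStability stub_innerApproximation

end Summit.CriticalPhenomena.SAWScalingLimit.Cruxes.ContinuityOfLimit.Birth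

end
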